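import Literature.Probability.LatticeModels.IsingDecoration
import Literature.Probability.LatticeModels.GKSInequalities
import Literature.Probability.LatticeModels.SharpnessProofs
import Literature.Probability.LatticeModels.LatticeLaplacianZd
import Summits.CriticalPhenomena.Ising3DConformalLimit.Theorems.PerfectScreeningSubharmonicOffOriginBetheCore
import HarnessLib

/-!
# Bethe-threshold lattice subharmonicity of Ising correlations off the source
# (crux `SubharmonicOffOrigin`, stmt-CriticalPhenomena-1341, route PerfectScreening; by-product)

The crux SubH asks for `6·G(x) ≤ Σᵢ (G(x+eᵢ) + G(x−eᵢ))`, `x ≠ 0`, for the CRITICAL plus-state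
two-point function `G = criticalTwoPoint 3` of `ℤ³` (open; `tanh β_c(3) = 0.2181…`).  This file
proves the sharp GRAPH-UNIFORM window of that inequality — the first lemma of the strategist's
idea `loop-o1-source-degree` (`Cruxes/SubharmonicOffOrigin/STRATEGY-CENSUS.md` §S4/§8, typed there
as `Strategist.BetheThreshold` / `BetheThresholdGeneral`):

* `finiteVolume_bethe` — for the nearest-neighbour Ising model on ANY locally finite graph `G`, any
  finite volume `Λ ∋ x`, `+` boundary condition, zero field, `β ≥ 0`, any site `o ≠ x`, and
  `(deg x − 1)·tanh β ≤ 1`:  `deg x · ⟨σ_oσ_x⟩⁺_Λ ≤ Σ_{y∼x} ⟨σ_oσ_y⟩⁺_Λ`;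
* `twoPointPlus_bethe` — the plus state of `ℤ^d`: `(2d−1)·tanh β ≤ 1`, `x ≠ 0` ⟹
  `2d·⟨σ₀σ_x⟩⁺_β ≤ Σᵢ (⟨σ₀σ_{x+eᵢ}⟩⁺_β + ⟨σ₀σ_{x−eᵢ}⟩⁺_β)`;
* `betheThresholdGeneral`, `betheThreshold` — the strategist's typed forms (`tanh β ≤ 1/(2d−1)`;
  `d = 3`: `tanh β ≤ 1/5`, i.e. `β ≤ artanh(1/5) = 0.2027 = 0.914·β_c(3)`), improving the landed
  high-temperature window `tanh 2β ≤ 1/3` (`β ≤ 0.1733`) of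
  `Psk.highTemperature_subharmonicOffOrigin`.

The threshold `tanh β = 1/(deg x − 1)` is the Bethe-lattice critical point and is SHARP for
graph-uniform statements: on the star `K_{1,n}` with the source `o` at a leaf, at the centre `x`
one has `n·⟨σ_oσ_x⟩ = n t > 1 + (n−1)t² = Σ_{y∼x}⟨σ_oσ_y⟩` iff `t > 1/(n−1)` (cdisprove's
`Disproof.lean` §(c)).  So no argument insensitive to the loop structure of `ℤ³` reaches `β_c(3)`;
this file records exactly how far the loop-free mechanism goes.

## Proof (x-deleted DLR expansion + first Griffiths inequality)

Fix `x ∈ Λ` with neighbours `N`, `n = #N`, `t = tanh β`, `h = Σ_{y∈N} σ_y`.  Summing the spin at `x`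
first (the two-step decomposition of the Boltzmann sums, Friedli–Velenik 2017 Lemma 6.7 /
eq. (6.5), tree `sum_isingWeight_fixed_eq_sum_sum` with `Λ' = {x}`; one-site weight
`e^{βσ_x h}`, tree `isingWeight_singleton`) gives, with `E` the Boltzmann factor of the edges not
touching `x` ("x-deleted system") and `Z` the partition function,
`Z⟨σ_oσ_x⟩ = 2 Σ E σ_o sinh(βh)` and `Z⟨σ_oσ_y⟩ = 2 Σ E σ_oσ_y cosh(βh)` (`y ∼ x`, `o ≠ x`).
The abstract core `bethe_core` then expands, pointwise, `e^{±βh} = cosh^n β Σ_{S⊆N} (±t)^{#S} σ_S`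
(`σ_y = ±1`), whence `n·sinh(βh)` and `Σ_y σ_y cosh(βh)` are `cosh^n β Σ_{T⊆N} c_T σ_T` with
coefficients `n·o_T`, `o_T = (t^{#T} − (−t)^{#T})/2`, respectively `Σ_{y∈N} e_{T∆{y}}`,
`e_S = (t^{#S} + (−t)^{#S})/2`; for `#T = k` odd the difference of coefficients is
`k t^{k−1} + (n−k)t^{k+1} − n t^k = t^{k−1}(1−t)(k − (n−k)t) ≥ t^{k−1}(1−t)(1 − (n−1)t) ≥ 0`, and for
`#T` even `o_T = 0 ≤ e`.  Since every moment `Σ E σ_o σ_T ≥ 0` by the first Griffiths inequality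
for the x-deleted system (a ferromagnetic GKS weight: tree `gksSum_spinProduct_nonneg`,
Friedli–Velenik 2017 Thm. 3.49; here `deleted_outer_gks_nonneg`), the inequality follows termwise.
The `ℤ^d` statement is the limit along plus boxes (tree `tendsto_isingTwoPoint_plus`,
`hasBoxLimit_isingCorr_plus_holds`, `sum_neighborFinset_zdGraph`).

References: S. Friedli, Y. Velenik, *Statistical Mechanics of Lattice Systems* (CUP 2017), Lemma 6.7
(DLR / two-step decomposition), Thm. 3.49 (GKS I), Thm. 3.17 (plus state) [FriedliVelenik2017];
R. B. Griffiths, J. Math. Phys. 8 (1967) 478.  No new definition, no named fact; helpers of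
stmt-CriticalPhenomena-1341 (`--supports`), not a proof of the crux.
-/

noncomputable section

open MeasureTheory Filter Topology Finset
open Literature.Probability.LatticeModels
open scoped symmDiff

namespace Summit.CriticalPhenomena.Ising3DConformalLimit.Theorems.PerfectScreening.Bethe

/-! ### Part B — finite volume, arbitrary locally finite graph, `+` boundary condition -/

section FiniteVolume

variable {V : Type*} [DecidableEq V] (G : SimpleGraph V) [G.LocallyFinite]

omit [DecidableEq V] in
/-- Outside the volume a configuration glued with the `+` boundary condition has spin `1`. -/
theorem spinAt_glue_plus_of_not_mem {S : Finset V} (τ : SpinConfig ↥S) {v : V} (hv : v ∉ S) :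
    spinAt v (glue S τ (.fixed 1)) = 1 := by
  rw [spinAt_glue_of_not_mem τ _ hv]
  simp [spinAt]

/-- Spin products of a `+`-glued configuration are spin products of the trace on the volume. -/
theorem spinProduct_glue_plus (S : Finset V) (τ : SpinConfig ↥S) (B : Finset V) :
    spinProduct B (glue S τ (.fixed 1)) = spinProduct (inVol S B) τ := by
  rw [spinProduct, spinProduct]
  have h1 : ∏ z ∈ inVol S B, spinAt z τ = ∏ v ∈ S.filter (· ∈ B), spinAt v (glue S τ (.fixed 1)) := by
    rw [← prod_inVol S B (fun v => spinAt v (glue S τ (.fixed 1)))]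
    exact Finset.prod_congr rfl fun z _ => (spinAt_glue_coe τ _ z).symm
  rw [h1, ← Finset.prod_filter_mul_prod_filter_not B (· ∈ S), Finset.filter_mem_eq_inter,
    Finset.filter_mem_eq_inter, Finset.inter_comm]
  have h2 : ∏ v ∈ B.filter (fun v => ¬ v ∈ S), spinAt v (glue S τ (.fixed 1)) = 1 :=
    Finset.prod_eq_one fun v hv => spinAt_glue_plus_of_not_mem τ (Finset.mem_filter.1 hv).2
  rw [h2, mul_one]

/-- A bond observable of a `+`-glued configuration is the spin product over the trace of the edge
(the support `isingSupp S (inl e)` of the GKS form of the Ising weight). -/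
theorem bondSpin_glue_plus_eq_spinProduct (S : Finset V) (τ : SpinConfig ↥S) {a b : V} (hab : a ≠ b) :
    bondSpin (glue S τ (.fixed 1)) s(a, b) = spinProduct (isingSupp S (.inl s(a, b))) τ := by
  rw [spinProduct_isingSupp_inl τ (.fixed 1) hab, bondSpin_mk]
  have h : ∀ v : V, (if v ∈ S then spinAt v (glue S τ (.fixed 1)) else 1) =
      spinAt v (glue S τ (.fixed 1)) := by
    intro v
    split_ifs with hv
    · rfl
    · exact (spinAt_glue_plus_of_not_mem τ hv).symm
  rw [h a, h b]

/-- **First Griffiths inequality for the `x`-deleted outer system.** The outer weight of the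
two-step (DLR) decomposition at the site `x` — the Boltzmann factor of the edges touching `Λ` but
not `x`, evaluated on the configuration of `Λ ∖ {x}` glued with `+` outside — is a ferromagnetic
GKS weight, so its unnormalised spin-product moments are nonnegative. -/
theorem deleted_outer_gks_nonneg {β : ℝ} (hβ : 0 ≤ β) (Λ : Finset V) (x : V) (B : Finset V) :
    0 ≤ ∑ τ₂ : ↥(Λ \ {x}) → ℤˣ,
      Real.exp (β * (∑ e ∈ edgesTouching G Λ \ edgesTouching G {x},
          bondSpin (glue (Λ \ {x}) τ₂ (.fixed 1)) e +
        0 * ∑ z ∈ Λ \ {x}, spinAt z (glue (Λ \ {x}) τ₂ (.fixed 1)))) *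
      spinProduct B (glue (Λ \ {x}) τ₂ (.fixed 1)) := by
  classical
  set Sₑ := edgesTouching G Λ \ edgesTouching G {x} with hSₑ
  have hw : ∀ τ₂ : ↥(Λ \ {x}) → ℤˣ,
      Real.exp (β * (∑ e ∈ Sₑ, bondSpin (glue (Λ \ {x}) τ₂ (.fixed 1)) e +
        0 * ∑ z ∈ Λ \ {x}, spinAt z (glue (Λ \ {x}) τ₂ (.fixed 1)))) =
      gksWeight Sₑ (fun _ => β) (fun e => isingSupp (Λ \ {x}) (.inl e)) τ₂ := by
    intro τ₂
    rw [gksWeight, gksHamiltonian, zero_mul, add_zero, Finset.mul_sum]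
    congr 1
    refine Finset.sum_congr rfl fun e he => ?_
    have he' : e ∈ G.edgeSet := (mem_edgesTouching_iff.1 (Finset.mem_sdiff.1 he).1).1
    induction e using Sym2.ind with
    | _ a b =>
      have hab : a ≠ b := G.ne_of_adj ((SimpleGraph.mem_edgeSet G).1 he')
      rw [bondSpin_glue_plus_eq_spinProduct (Λ \ {x}) τ₂ hab]
  have hrw : ∀ τ₂ : ↥(Λ \ {x}) → ℤˣ,
      Real.exp (β * (∑ e ∈ Sₑ, bondSpin (glue (Λ \ {x}) τ₂ (.fixed 1)) e +
        0 * ∑ z ∈ Λ \ {x}, spinAt z (glue (Λ \ {x}) τ₂ (.fixed 1)))) *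
        spinProduct B (glue (Λ \ {x}) τ₂ (.fixed 1)) =
      spinProduct (inVol (Λ \ {x}) B) τ₂ *
        gksWeight Sₑ (fun _ => β) (fun e => isingSupp (Λ \ {x}) (.inl e)) τ₂ := by
    intro τ₂
    rw [hw, spinProduct_glue_plus, mul_comm]
  rw [Finset.sum_congr rfl fun τ₂ _ => hrw τ₂]
  exact gksSum_spinProduct_nonneg Sₑ (fun _ => β) (fun e => isingSupp (Λ \ {x}) (.inl e))
    (fun _ _ => hβ) (inVol (Λ \ {x}) B)

/-- **Finite-volume Bethe-threshold inequality.** For the nearest-neighbour Ising model on a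
locally finite graph `G`, a finite volume `Λ`, the `+` boundary condition, zero field, `β ≥ 0`,
sites `x, o ∈ Λ` with `o ≠ x`, and `(deg x − 1) · tanh β ≤ 1`:
`deg x · ⟨σ_o σ_x⟩⁺_Λ ≤ ∑_{y ∼ x} ⟨σ_o σ_y⟩⁺_Λ`.  Proof: write both sides with the two-step (DLR)
decomposition of the Boltzmann sums at `x` (`sum_isingWeight_fixed_eq_sum_sum`, Λ' = {x}); the
spin at `x` integrates to `2 sinh(β h_x)` against `σ_x` and to `2 cosh(β h_x)` against `1`
(`h_x = ∑_{y∼x} σ_y`), and the abstract core `bethe_core` applies to the outer system, whose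
spin-product moments are nonnegative by the first Griffiths inequality
(`deleted_outer_gks_nonneg`). -/
theorem finiteVolume_bethe {β : ℝ} (hβ : 0 ≤ β) {Λ : Finset V} {x o : V} (hx : x ∈ Λ)
    (hox : o ≠ x) (ht : ((G.degree x : ℝ) - 1) * Real.tanh β ≤ 1) :
    (G.degree x : ℝ) * isingExpect G Λ β 0 .plus (spinPair o x) ≤
      ∑ y ∈ G.neighborFinset x, isingExpect G Λ β 0 .plus (spinPair o y) := by
  classical
  have hplus : (BoundaryCondition.plus : BoundaryCondition V) = .fixed 1 := rfl
  set N := G.neighborFinset x with hN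
  have hcard : (#N : ℝ) = G.degree x := by rw [hN, SimpleGraph.card_neighborFinset_eq_degree]
  have hxN : ∀ y ∈ N, y ≠ x := fun y hy => ((SimpleGraph.mem_neighborFinset G x y).1 hy).ne'
  set Z := isingPartitionFunction G Λ β 0 .plus with hZdef
  have hZ : 0 < Z := isingPartitionFunction_pos G Λ β 0 .plus
  have hEx : ∀ y : V, isingExpect G Λ β 0 .plus (spinPair o y) =
      (∑ τ : Λ → ℤˣ, isingWeight G Λ β 0 .plus τ * spinPair o y (glue Λ τ .plus)) / Z :=
    fun y => isingExpect_eq_sum_div G Λ 0 .plus β (measurable_spinPair o y)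
  -- the two-step decomposition at `x`
  have hsub : ({x} : Finset V) ⊆ Λ := Finset.singleton_subset_iff.2 hx
  set ξ : (↥(Λ \ {x}) → ℤˣ) → SpinConfig V := fun τ₂ => glue (Λ \ {x}) τ₂ (.fixed 1) with hξ
  set E : (↥(Λ \ {x}) → ℤˣ) → ℝ := fun τ₂ =>
    Real.exp (β * (∑ e ∈ edgesTouching G Λ \ edgesTouching G {x}, bondSpin (ξ τ₂) e +
      0 * ∑ z ∈ Λ \ {x}, spinAt z (ξ τ₂))) with hE
  set H : (↥(Λ \ {x}) → ℤˣ) → ℝ := fun τ₂ => ∑ y ∈ N, spinAt y (ξ τ₂) with hH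
  have hxmem : x ∈ ({x} : Finset V) := Finset.mem_singleton_self x
  -- inner sums
  have inner_x : ∀ τ₂ : ↥(Λ \ {x}) → ℤˣ,
      ∑ τ₁ : ↥({x} : Finset V) → ℤˣ, isingWeight G {x} β 0 (.fixed (ξ τ₂)) τ₁ *
          spinPair o x (glue {x} τ₁ (.fixed (ξ τ₂))) =
        spinAt o (ξ τ₂) * (2 * Real.sinh (β * H τ₂)) := by
    intro τ₂
    have hterm : ∀ τ₁ : ↥({x} : Finset V) → ℤˣ,
        isingWeight G {x} β 0 (.fixed (ξ τ₂)) τ₁ * spinPair o x (glue {x} τ₁ (.fixed (ξ τ₂))) =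
          Real.exp (β * ((((τ₁ ⟨x, hxmem⟩ : ℤˣ) : ℤ) : ℝ) * H τ₂)) *
            (spinAt o (ξ τ₂) * (((τ₁ ⟨x, hxmem⟩ : ℤˣ) : ℤ) : ℝ)) := by
      intro τ₁
      rw [isingWeight_singleton G x β (ξ τ₂) τ₁, ← hN, glue_singleton_eq_update, spinPair]
      simp only [spinAt, Function.update_of_ne hox, Function.update_self, hH]
    rw [Finset.sum_congr rfl fun τ₁ _ => hterm τ₁, sum_config_singleton]
    simp only [Units.val_one, Units.val_neg, Int.cast_one, Int.cast_neg, one_mul, neg_mul, mul_one,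
      mul_neg_one, Real.sinh_eq]
    ring
  have inner_y : ∀ y ∈ N, ∀ τ₂ : ↥(Λ \ {x}) → ℤˣ,
      ∑ τ₁ : ↥({x} : Finset V) → ℤˣ, isingWeight G {x} β 0 (.fixed (ξ τ₂)) τ₁ *
          spinPair o y (glue {x} τ₁ (.fixed (ξ τ₂))) =
        spinAt o (ξ τ₂) * spinAt y (ξ τ₂) * (2 * Real.cosh (β * H τ₂)) := by
    intro y hy τ₂
    have hterm : ∀ τ₁ : ↥({x} : Finset V) → ℤˣ,
        isingWeight G {x} β 0 (.fixed (ξ τ₂)) τ₁ * spinPair o y (glue {x} τ₁ (.fixed (ξ τ₂))) =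
          Real.exp (β * ((((τ₁ ⟨x, hxmem⟩ : ℤˣ) : ℤ) : ℝ) * H τ₂)) *
            (spinAt o (ξ τ₂) * spinAt y (ξ τ₂)) := by
      intro τ₁
      rw [isingWeight_singleton G x β (ξ τ₂) τ₁, ← hN, glue_singleton_eq_update, spinPair]
      simp only [spinAt, Function.update_of_ne hox, Function.update_of_ne (hxN y hy), hH]
    rw [Finset.sum_congr rfl fun τ₁ _ => hterm τ₁, sum_config_singleton]
    simp only [Units.val_one, Units.val_neg, Int.cast_one, Int.cast_neg, one_mul, neg_mul,
      Real.cosh_eq]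
    ring
  -- numerators
  have num_x : ∑ τ : Λ → ℤˣ, isingWeight G Λ β 0 .plus τ * spinPair o x (glue Λ τ .plus) =
      ∑ τ₂ : ↥(Λ \ {x}) → ℤˣ, E τ₂ * (spinAt o (ξ τ₂) * (2 * Real.sinh (β * H τ₂))) := by
    rw [hplus, sum_isingWeight_fixed_eq_sum_sum G hsub 1 β 0 (spinPair o x)]
    exact Finset.sum_congr rfl fun τ₂ _ => by rw [inner_x τ₂]
  have num_y : ∀ y ∈ N, ∑ τ : Λ → ℤˣ, isingWeight G Λ β 0 .plus τ * spinPair o y (glue Λ τ .plus) =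
      ∑ τ₂ : ↥(Λ \ {x}) → ℤˣ, E τ₂ * (spinAt o (ξ τ₂) * spinAt y (ξ τ₂) * (2 * Real.cosh (β * H τ₂))) := by
    intro y hy
    rw [hplus, sum_isingWeight_fixed_eq_sum_sum G hsub 1 β 0 (spinPair o y)]
    exact Finset.sum_congr rfl fun τ₂ _ => by rw [inner_y y hy τ₂]
  -- the abstract core applied to the outer system
  have hcore := bethe_core E (fun τ₂ => spinAt o (ξ τ₂)) (fun y τ₂ => spinAt y (ξ τ₂)) N
    (fun y _ τ₂ => spinAt_eq_one_or_eq_neg_one y (ξ τ₂))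
    (fun T _ => by
      have h := deleted_outer_gks_nonneg G hβ Λ x ({o} ∆ T)
      refine h.trans_eq (Finset.sum_congr rfl fun τ₂ _ => ?_)
      rw [← spinProduct_mul_eq_spinProduct_symmDiff, spinProduct, Finset.prod_singleton, spinProduct,
        mul_assoc])
    hβ (by rw [hcard]; exact ht)
  -- assemble
  rw [hEx x, Finset.sum_congr rfl fun y hy => hEx y, ← Finset.sum_div, ← mul_div_assoc,
    div_le_div_iff_of_pos_right hZ, num_x, Finset.sum_congr rfl fun y hy => num_y y hy, ← hcard]
  have hL : ∑ τ₂ : ↥(Λ \ {x}) → ℤˣ, E τ₂ * (spinAt o (ξ τ₂) * (2 * Real.sinh (β * H τ₂))) =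
      2 * ∑ τ₂ : ↥(Λ \ {x}) → ℤˣ, E τ₂ * spinAt o (ξ τ₂) * Real.sinh (β * ∑ y ∈ N, spinAt y (ξ τ₂)) := by
    rw [Finset.mul_sum]
    exact Finset.sum_congr rfl fun τ₂ _ => by simp only [hH]; ring
  have hR : ∀ y ∈ N, ∑ τ₂ : ↥(Λ \ {x}) → ℤˣ,
      E τ₂ * (spinAt o (ξ τ₂) * spinAt y (ξ τ₂) * (2 * Real.cosh (β * H τ₂))) =
      2 * ∑ τ₂ : ↥(Λ \ {x}) → ℤˣ,
        E τ₂ * spinAt o (ξ τ₂) * spinAt y (ξ τ₂) * Real.cosh (β * ∑ z ∈ N, spinAt z (ξ τ₂)) := by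
    intro y _
    rw [Finset.mul_sum]
    exact Finset.sum_congr rfl fun τ₂ _ => by simp only [hH]; ring
  rw [hL, Finset.sum_congr rfl hR, ← Finset.mul_sum]
  nlinarith [hcore]

end FiniteVolume

/-! ### Part C — the plus state of `ℤ^d` -/

/-- **Bethe-threshold subharmonicity of the plus-state two-point function of `ℤ^d` off the
origin.** For `β ≥ 0` with `(2d − 1) · tanh β ≤ 1` and `x ≠ 0`:
`2d · ⟨σ₀σ_x⟩⁺_β ≤ ∑ᵢ (⟨σ₀σ_{x+eᵢ}⟩⁺_β + ⟨σ₀σ_{x−eᵢ}⟩⁺_β)`. -/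
theorem twoPointPlus_bethe {d : ℕ} {β : ℝ} (hβ : 0 ≤ β)
    (ht : (2 * (d : ℝ) - 1) * Real.tanh β ≤ 1) {x : Site d} (hx : x ≠ 0) :
    2 * d * twoPointPlus d β x ≤
      ∑ i : Fin d, (twoPointPlus d β (x + Pi.single i 1) + twoPointPlus d β (x - Pi.single i 1)) := by
  classical
  have htwo : ∀ z : Site d, Tendsto (fun L : ℕ => isingExpect (zdGraph d) (box d L) β 0 .plus (spinPair 0 z))
      atTop (𝓝 (twoPointPlus d β z)) := fun z =>
    tendsto_isingTwoPoint_plus hasBoxLimit_isingCorr_plus_holds hβ z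
  set N := (zdGraph d).neighborFinset x with hN
  have hdeg : ((zdGraph d).degree x : ℝ) = 2 * d := by
    rw [← SimpleGraph.card_neighborFinset_eq_degree, card_neighborFinset_zdGraph_holds x]
    push_cast
    ring
  have hev : ∀ᶠ L : ℕ in atTop,
      2 * (d : ℝ) * isingExpect (zdGraph d) (box d L) β 0 .plus (spinPair 0 x) ≤
        ∑ y ∈ N, isingExpect (zdGraph d) (box d L) β 0 .plus (spinPair 0 y) := by
    filter_upwards [eventually_mem_box x] with L hL
    have h := finiteVolume_bethe (zdGraph d) hβ hL (Ne.symm hx) (by rw [hdeg]; exact ht)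
    rwa [hdeg] at h
  have hlim1 := (htwo x).const_mul (2 * (d : ℝ))
  have hlim2 := tendsto_finsetSum N fun y _ => htwo y
  have hle := le_of_tendsto_of_tendsto hlim1 hlim2 hev
  rwa [hN, sum_neighborFinset_zdGraph (twoPointPlus d β) x] at hle

/-- **General dimension, the strategist's typed form `BetheThresholdGeneral`**: for `d ≥ 1`,
`β ≥ 0` with `tanh β ≤ 1/(2d − 1)` and `x ≠ 0`,
`2d·⟨σ₀σ_x⟩⁺_β ≤ Σᵢ (⟨σ₀σ_{x+eᵢ}⟩⁺_β + ⟨σ₀σ_{x−eᵢ}⟩⁺_β)` on `ℤ^d` (x-deleted DLR expansion + GKS I,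
Friedli–Velenik 2017 Lemma 6.7 and Thm. 3.49). -/
theorem betheThresholdGeneral : ∀ (d : ℕ), 1 ≤ d → ∀ β : ℝ, 0 ≤ β → Real.tanh β ≤ 1 / (2 * d - 1) →
    ∀ x : Site d, x ≠ 0 →
      2 * d * twoPointPlus d β x ≤
        ∑ i : Fin d, (twoPointPlus d β (x + Pi.single i 1) + twoPointPlus d β (x - Pi.single i 1)) := by
  intro d hd β hβ hβt x hx
  have hpos : (0 : ℝ) < 2 * d - 1 := by
    have h1 : (1 : ℝ) ≤ d := by exact_mod_cast hd
    linarith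
  have ht : (2 * (d : ℝ) - 1) * Real.tanh β ≤ 1 := by
    rw [le_div_iff₀ hpos] at hβt
    linarith
  exact twoPointPlus_bethe hβ ht hx

/-- **`d = 3`, the registered form** (the strategist's `BetheThreshold`): for every `β ≥ 0` with
`tanh β ≤ 1/5` and every `x ≠ 0`,
`6 · ⟨σ₀σ_x⟩⁺_β ≤ ∑ᵢ (⟨σ₀σ_{x+eᵢ}⟩⁺_β + ⟨σ₀σ_{x−eᵢ}⟩⁺_β)` on `ℤ³`. -/
theorem betheThreshold : ∀ β : ℝ, 0 ≤ β → Real.tanh β ≤ 1 / 5 → ∀ x : Site 3, x ≠ 0 → 6 * twoPointPlus 3 β x ≤ ∑ i : Fin 3, (twoPointPlus 3 β (x + Pi.single i 1) + twoPointPlus 3 β (x - Pi.single i 1)) := by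
  intro β hβ hβt x hx
  have ht : (2 * ((3 : ℕ) : ℝ) - 1) * Real.tanh β ≤ 1 := by
    push_cast
    linarith
  have h := twoPointPlus_bethe hβ ht hx
  push_cast at h
  linarith

end Summit.CriticalPhenomena.Ising3DConformalLimit.Theorems.PerfectScreening.Bethe

end
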